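import Literature.MathematicalPhysics.QuantumFieldTheory.Dimock2011to13.LargeFieldRegionVolume
import Literature.MathematicalPhysics.QuantumFieldTheory.Balaban1983to89.B12Decay510Window

/-!
# A connected graph joining two cubes at sup-distance `≥ s` has length `≥ s` — the geometric input of
[Dimock2013BalabanII] §3.13 Lemma 3.17 (*"any tree joining the LM cubes in Z ∩ Ω_{k+1} must have length at least
r_{k+1}LM"*), PROVED on the cell's flat and periodic cube carriers

**Citation header (reproduction of PUBLISHED work; template of the Balaban lattice Yang–Mills cell).**
J. Dimock, *The renormalization group according to Balaban. II. Large fields*, J. Math. Phys. **54** (2013) 092301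
(= arXiv:1212.5562v2) [Dimock2013BalabanII], §3.13 proof of Lemma 3.17 \label{third}, TeX L5359–5363 (TeX source
held by the cell, `inputs/files/dimock/src/1212.5562/1212.5562.tex`, sha256[:16] 75c5792fc48eacbc), verbatim: *"Now
consider terms in (spitoon2) with Z # Λ_{k+1}. … Since also Z # Λ_k we have Z # Ω_{k+1} and so Z must have cubes in
Ω_{k+1} on the boundary and in Λ_{k+1}, and these are necessarily a distance at least r_{k+1}LM apart. Then any tree
joining the LM cubes in Z ∩ Ω_{k+1} must have length at least r_{k+1}LM. Hence LMd_{LM}(Z, mod Ω^c_{k+1}) ≥ LMr_{k+1}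
and therefore d_{LM}(Z, mod Ω^c_{k+1}) ≥ r_{k+1}."*; with §3.1.2 TeX L1690–1694 for the distance, verbatim: *"M d_M(X,
mod Ω^c_k) = inf_{τ on X} ℓ(τ) where the infimum is over all continuuum* ⟦sic⟧ *tree graphs τ contained in X and
intersecting every M-cube in X ∩ Ω_k, and ℓ(τ) is the length of τ"*, and §3.5 TeX L2726–2727 for the separation,
verbatim: *"In generating Ω_{k+1}^c from (Λ̄_k)^c we add at least 5[r_{k+1}] layers of LM-cubes so d((Λ̄_k)^c, Ω_{k+1})
≥ 5[r_{k+1}]LM. This is the required separation at this scale."*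

**What is proved (kernel-checked, zero `sorry`).**  The one geometric fact the quoted step uses — *a connected graph
that meets two cubes whose indices are at sup-distance ≥ s + 1 (i.e. the closed unit cubes are at distance ≥ s) has
length ≥ s* — on the carriers of the cell's polymer geometry (`Balaban1983to89.TreeLength`: unit cubes `cube x`,
`x ∈ ℤ^d`, of `ℝ^d` with the SUP metric; polygonal graphs `T : List (Seg d)` with `carrier`, `len`):
* Part 1 — `dist_corner_sub_one_le` (points of two cubes are at distance ≥ the index distance − 1) and the carrier-level
  **`le_len_of_meets_far_cubes`**: `IsPreconnected (carrier T)`, `T` meets `cube x` and `cube y`, `s + 1 ≤ ‖x − y‖_∞`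
  ⇒ `s ≤ len T` — from the tree lemma `B12Decay510Window.dist_le_len` (two points of a connected polygonal graph are
  at sup-distance at most its length; b02 lineage), which this file REUSES (its `dist_corner_le_treeLen` gives the
  flat `‖x − y‖_∞ ≤ d(X) + 2`; the present statements lose `1`, cover the Steiner length, and — the point — the torus).
* Part 2 — flat consequences: `le_len_of_sAdmissible` / `le_steinerLen` / `le_treeLen` (for `a, b ∈ Y` with `‖a − b‖_∞
  ≥ s + 1`: `s ≤ ℓ̃(Y) ≤ d(Y)` — the Steiner length is the smaller, so this covers the *"mod Ω^c"* distance, whose trees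
  need only meet the cubes of `X ∩ Ω`, cf. `TreeLength.SAdmissible`).
* Part 3 — the PERIODIC carrier (`TreeLengthTorus`: cubes indexed by `(ℤ/N)^d`, admissible graphs in the universal
  cover, `torusTreeLen`; `RegionVolume.tball a s` = the cube `a` enlarged by `s` layers, [Dimock2013BalabanII] TeX
  L1849): `far_lifts_of_not_mem_tball` (if `b ∉ tball a s` then ANY two lifts are at sup-distance ≥ s + 1),
  **`le_len_of_tAdmissible`** and **`le_torusTreeLen`**: a torus-admissible graph of a family containing `a` and `b`
  with `b ∉ a^{∼s}` has length ≥ s; hence `d(X̄) ≥ s`.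

**What is NOT claimed.**  Nothing about D2's sets `Z, Ω_{k+1}, Λ_{k+1}` themselves (that a polymer `Z # Λ_k`,
`Z # Λ_{k+1}` has a cube of `Ω_{k+1}` adjacent to `Ω^c_{k+1}` and a cube in `Λ_{k+1}` outside the `5[r_{k+1}]`-layer
enlargement is the construction L2721–2727, not re-typed here); the *"mod Ω^c"* distance itself is not given a
separate torus definition (the flat Steiner length `TreeLength.steinerLen` is the cell's object; on the torus only
`torusTreeLen` exists and Part 3 is stated for it and at graph level, which is what a *"mod"* variant would consume).
Dimock's papers are the cell's TEMPLATE, published and refereed; this file supplies the kernel form of one sentence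
used as a HYPOTHESIS (`hext : rsep r (L * lamk) ≤ d`) by `Dimock2011to13.BoundaryTermLedger.old_term_tiny_every_step`.
Value = geometry bookkeeping; NOT summit progress.

Cell records: TEMPLATE.md §15.2 UPTAKE (v8.38) names this input; unit `b2b-balaban-template` gen 26 (v1), gen 27 (v1.1 =
XREAD C-pv12g19-4 D1 fold, docstring of `le_torusTreeLen` only; declarations byte-identical).  NEW leaf;
imports `Dimock2011to13.LargeFieldRegionVolume` (for `RegionVolume.tball`/`box`; through it `Balaban1983to89.
TreeLengthTorus` / `TreeLength`) and `Balaban1983to89.B12Decay510Window` (for `dist_le_len`); modifies nothing.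
-/

noncomputable section

open Metric
open Literature.MathematicalPhysics.QuantumFieldTheory.Balaban1983to89
open Literature.MathematicalPhysics.QuantumFieldTheory.Balaban1983to89.B13ScaleTransfer
open Literature.MathematicalPhysics.QuantumFieldTheory.Balaban1983to89.TreeLength
open Literature.MathematicalPhysics.QuantumFieldTheory.Balaban1983to89.TreeLengthTorus
open Literature.MathematicalPhysics.QuantumFieldTheory.Balaban1983to89.B12Decay510Window (dist_le_len)
open Literature.MathematicalPhysics.QuantumFieldTheory.Dimock2011to13.RegionVolume (box mem_box tball mem_tball)

namespace Literature.MathematicalPhysics.QuantumFieldTheory.Dimock2011to13.SeparatedCubes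

variable {d : ℕ}

/-! ## Part 1. Carrier level: a connected graph meeting two far cubes is long -/

/-- Points of two closed unit cubes are at sup-distance at least the sup-distance of the cube indices minus one:
`p ∈ □_x`, `q ∈ □_y` ⇒ `‖x − y‖_∞ − 1 ≤ ‖p − q‖_∞`. [folklore] -/
theorem dist_corner_sub_one_le {x y : Pt d} {p q : RPt d} (hp : p ∈ cube x) (hq : q ∈ cube y) :
    dist (corner x) (corner y) - 1 ≤ dist p q := by
  rw [sub_le_iff_le_add]
  refine (dist_pi_le_iff (by positivity)).2 fun i => ?_
  have hpi := (mem_cube.1 hp) i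
  have hqi := (mem_cube.1 hq) i
  have hpq : dist (p i) (q i) ≤ dist p q := dist_le_pi_dist p q i
  rw [Real.dist_eq] at hpq ⊢
  simp only [corner]
  have := abs_sub_abs_le_abs_sub ((x i : ℝ) - y i) (p i - q i)
  have h2 : |((x i : ℝ) - y i) - (p i - q i)| ≤ 1 := by
    rw [abs_le]; constructor <;> linarith [hpi.1, hpi.2, hqi.1, hqi.2]
  linarith

/-- **A CONNECTED GRAPH JOINING TWO CUBES AT DISTANCE ≥ s HAS LENGTH ≥ s** — the geometric content of
[Dimock2013BalabanII] §3.13, verbatim: *"these are necessarily a distance at least r_{k+1}LM apart. Then any tree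
joining the LM cubes in Z ∩ Ω_{k+1} must have length at least r_{k+1}LM"* — PROVED at carrier level (unit cubes, sup
metric): if `carrier T` is preconnected and meets `□_x` and `□_y` with `‖x − y‖_∞ ≥ s + 1` then `len T ≥ s` (via
`B12Decay510Window.dist_le_len`). [cite: Dimock2013BalabanII, §3.13 proof of Lemma 3.17 (arXiv:1212.5562v2 TeX L5361–5362)] -/
theorem le_len_of_meets_far_cubes {T : List (Seg d)} (hT : IsPreconnected (carrier T)) {x y : Pt d}
    (hx : (carrier T ∩ cube x).Nonempty) (hy : (carrier T ∩ cube y).Nonempty) {s : ℝ}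
    (hfar : s + 1 ≤ dist (corner x) (corner y)) : s ≤ len T := by
  obtain ⟨p, hpT, hpx⟩ := hx
  obtain ⟨q, hqT, hqy⟩ := hy
  linarith [dist_corner_sub_one_le hpx hqy, dist_le_len hT hpT hqT]

/-! ## Part 2. Flat consequences: Steiner length and tree length of a family with two far cubes -/

/-- A Steiner-admissible graph of a family containing two cubes at index distance `≥ s + 1` has length `≥ s`.
[cite: Dimock2013BalabanII, §3.13 proof of Lemma 3.17 (arXiv:1212.5562v2 TeX L5361–5363)] -/
theorem le_len_of_sAdmissible {Y : Finset (Pt d)} {T : List (Seg d)} (hT : SAdmissible Y T) {a b : Pt d}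
    (ha : a ∈ Y) (hb : b ∈ Y) {s : ℝ} (hfar : s + 1 ≤ dist (corner a) (corner b)) : s ≤ len T :=
  le_len_of_meets_far_cubes hT.connected.isPreconnected (hT.meets a ha) (hT.meets b hb) hfar

/-- `ℓ̃(Y) ≥ s` when `Y` contains two cubes at index distance `≥ s + 1` (the Steiner length only asks the graph to MEET
the cubes of `Y` — the shape of D2's *"mod Ω^c"* distance, TeX L1690–1694).
[cite: Dimock2013BalabanII, §3.13 proof of Lemma 3.17 (arXiv:1212.5562v2 TeX L5361–5363)] -/
theorem le_steinerLen {Y : Finset (Pt d)} {a b : Pt d} (ha : a ∈ Y) (hb : b ∈ Y) {s : ℝ}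
    (hfar : s + 1 ≤ dist (corner a) (corner b)) : s ≤ steinerLen Y :=
  TreeLength.le_steinerLen (exists_sAdmissible ⟨a, ha⟩) fun _ hT => le_len_of_sAdmissible hT ha hb hfar

/-- `d(Y) ≥ s` for a localization domain `Y` (non-empty, face-connected) containing two cubes at index distance
`≥ s + 1`. [cite: Dimock2013BalabanII, §3.13 proof of Lemma 3.17 (arXiv:1212.5562v2 TeX L5361–5363)] -/
theorem le_treeLen {Y : Finset (Pt d)} (hc : FaceConnected Y) {a b : Pt d} (ha : a ∈ Y) (hb : b ∈ Y) {s : ℝ}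
    (hfar : s + 1 ≤ dist (corner a) (corner b)) : s ≤ treeLen Y :=
  (le_steinerLen ha hb hfar).trans (steinerLen_le_treeLen ⟨a, ha⟩ hc)

/-! ## Part 3. The periodic carrier: `b ∉ a^{∼s}` forces every pair of lifts `≥ s + 1` apart -/

variable {N : ℕ}

/-- On the torus `(ℤ/N)^d`: if the cube `b` is NOT in the enlargement `a^{∼s} = tball a s` of `a` by `s` layers, then
any lift `x` of `a` and any lift `y` of `b` are at sup-distance `≥ s + 1` in `ℤ^d`. [folklore] -/
theorem far_lifts_of_not_mem_tball [NeZero N] {a b : TPt d N} {s : ℕ} (hfar : b ∉ tball a s) {x y : Pt d}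
    (hx : proj N x = a) (hy : proj N y = b) : (s : ℝ) + 1 ≤ dist (corner x) (corner y) := by
  by_contra hlt
  rw [not_le] at hlt
  apply hfar
  -- every coordinate of y - x is an integer of absolute value < s + 1, hence ≤ s
  have hv : y - x ∈ box d s := by
    refine mem_box.2 fun i => ?_
    have hi : dist (corner x i) (corner y i) < (s : ℝ) + 1 := lt_of_le_of_lt (dist_le_pi_dist _ _ i) hlt
    rw [Real.dist_eq] at hi
    simp only [corner] at hi
    have h1 : (((|y i - x i| : ℤ)) : ℝ) < (s : ℝ) + 1 := by
      rw [Int.cast_abs, Int.cast_sub, abs_sub_comm]; exact hi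
    have h2 : (|y i - x i| : ℤ) < (s : ℤ) + 1 := by exact_mod_cast h1
    have hint : |y i - x i| ≤ (s : ℤ) := Int.lt_add_one_iff.1 h2
    simp only [Pi.sub_apply]
    exact abs_le.1 hint
  refine mem_tball.2 ⟨y - x, hv, ?_⟩
  rw [← hx, ← hy]
  funext i
  simp [proj]

/-- **ON THE TORUS**: a torus-admissible graph (in the universal cover) of a family `X̄` containing cubes `a` and `b`
with `b ∉ a^{∼s}` has length `≥ s` — [Dimock2013BalabanII] §3.13's *"any tree joining the LM cubes … must have length
at least r_{k+1}LM"* on the periodic carrier of [Balaban1987RG1] p. 257.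
[cite: Dimock2013BalabanII, §3.13 proof of Lemma 3.17 (arXiv:1212.5562v2 TeX L5361–5363)] -/
theorem le_len_of_tAdmissible [NeZero N] {X : Finset (TPt d N)} {T : List (Seg d)} (hT : TAdmissible X T)
    {a b : TPt d N} (ha : a ∈ X) (hb : b ∈ X) {s : ℕ} (hfar : b ∉ tball a s) : (s : ℝ) ≤ len T := by
  obtain ⟨x, hx, hxT⟩ := hT.meets a ha
  obtain ⟨y, hy, hyT⟩ := hT.meets b hb
  exact le_len_of_meets_far_cubes hT.connected.isPreconnected hxT hyT (far_lifts_of_not_mem_tball hfar hx hy)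

/-- `d(X̄) ≥ s` on the torus for a localization domain `X̄` (non-empty, face-connected) containing cubes `a`, `b` with
`b ∉ a^{∼s}` — so a polymer meeting both `Λ_{k+1}` and the boundary of `Ω_{k+1}`, which are `≥ r_{k+1}` layers apart,
has `d ≥ r_{k+1}` (the SHAPE of the hypothesis `hext` of `BoundaryTermLedger.old_term_tiny_every_step`; the ledger's
`d` there is D2's `d_{LM}(Z, mod Ω^c_{k+1})` (TeX L5338) `≤ d(Z̄)`, so this FULL-length bound is implied by, not a
substitute for, the mod bound — which is Part 1 at graph level: `le_len_of_meets_far_cubes` ∘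
`far_lifts_of_not_mem_tball` applied to a mod-admissible tree, exactly as the header's *What is NOT claimed* says;
v1.1 precision, XREAD C-pv12g19-4 D1).
[cite: Dimock2013BalabanII, §3.13 proof of Lemma 3.17 (arXiv:1212.5562v2 TeX L5361–5363)] -/
theorem le_torusTreeLen [NeZero N] {X : Finset (TPt d N)} (hc : TFaceConnected X) {a b : TPt d N} (ha : a ∈ X)
    (hb : b ∈ X) {s : ℕ} (hfar : b ∉ tball a s) : (s : ℝ) ≤ torusTreeLen X := by
  obtain ⟨T₀, hT₀, -⟩ := exists_tAdmissible ⟨a, ha⟩ hc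
  exact TreeLengthTorus.le_torusTreeLen ⟨T₀, hT₀⟩ fun T hT => le_len_of_tAdmissible hT ha hb hfar

end Literature.MathematicalPhysics.QuantumFieldTheory.Dimock2011to13.SeparatedCubes
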